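import Summits.BirchSwinnertonDyer.BirchSwinnertonDyer.Theorems.SylvesterTwoHeegnerIndexGeneratorNotHalvable
import Summits.BirchSwinnertonDyer.BirchSwinnertonDyer.Theorems.SylvesterTwoHeegnerIndexTwoInertParity
import Literature.NumberTheory.EllipticCurves.HuShuYin2019.SylvesterDVFamilyProofs
import HarnessLib

/-!
# Route `SylvesterTwoHeegnerIndex` (rung K7t), item 19580 `TwoAdicPairHSY`: the EXACT `2`-adic
# valuation from the height identity, and `ord₂ q = 2m`, `m ∈ ℕ` — parity (x1b) ∧ non-negativity
# (this seat) assembled in `θ`-currency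

Cell `bsd-cm`, seat `bsd-cm-two` (prover-bsd-cm-two-g5-0; planner D104 (ii): ASSEMBLY). PARTITION
(D55): CornerF at `p = 2` (B14/O12) × 𝒞_HSY × `p = 2` — types-the-object-of (kernel helper
`--supports stmt-BirchSwinnertonDyer-19580`); closes no cell and no item; BSD is not claimed.
Everything is PROVED (no named fact, no definition). Inputs BY NAME: x1b GEN 48's
`SylvesterTwoCMNormForm.canonicalHeight_zsmul_add_zsmul_omegaRot` (norm form),
`…canonicalHeight_add_of_isOfFinAddOrder`, `…even_padicValRat_two_of_height_identity` (PARITY), and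
this seat's `SylvesterTwoNonneg.padicValRat_two_coordinate_nonneg` /
`…two_le_padicValRat_two_coordinate_of_twoDivisible` (NON-NEGATIVITY).

* §1 `padicValRat_two_of_height_identity` — on a Mordell equation over a number field `K ∋ ω` with
  `θ = [ω]`: if `P` is non-torsion, `n·Y = a·P + b·θP + T` (`n ≠ 0`, `T` torsion) and a rational
  `q ≠ 0` satisfies `q·ĥ(P) = 2^i·ĥ(Y)`, then `q = 2^i·(a² − ab + b²)/n²` and
  **`ord₂ q = i + ord₂((a² − ab + b²)/n²)`** (the exact form of the step x1b's parity theorem uses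
  internally).
* §2 on `E_p ⊗ K` (`K/ℚ` quadratic, `p` an odd prime), `P` Hu–Shu–Yin's rational generator (infinite
  order; every rational-coordinate point an integer multiple mod torsion), `q·ĥ(P) = 2^i·ĥ(Y)`:
  `exists_nat_padicValRat_two_eq_of_generator` — `i = 0` ⇒ `ord₂ q = 2m`, `m ∈ ℕ` (the `p ≡ 4 (9)`
  layer, UNCONDITIONAL in the kernel); `exists_nat_padicValRat_two_eq_of_twoDivisible` — `i = −2` and
  `Y ∈ 2·E_p(K) + tors` (MEMO bsd-cm-two THEOREM C, displayed hypothesis, NOT in print) ⇒ the same.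
  Here `q = #Ш_an(E_p)·#Ш_an(E_{3p²})` once Hu–Shu–Yin's display (bsd) is supplied (x1b's cited fact,
  next file): these two theorems ARE the crux `TwoAdicPairHSY` class-wide in `θ`-currency, modulo
  that one printed identity (and Theorem C for `p ≡ 7 (9)`).

## References
* Y. Hu, J. Shu, H. Yin, Trans. AMS 372 (2019) = arXiv:1708.05266, pp. 8, 11, 12.
* MEMO bsd-cm-two v2.6 §15 (Thm B′/B″, Thm C).
-/

set_option autoImplicit false
-- the Summit-side namespace `Summit.BirchSwinnertonDyer.BirchSwinnertonDyer.…` (summit = problem) is mandated by D-0017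
set_option linter.dupNamespace false

noncomputable section

open scoped Classical

open WeierstrassCurve WeierstrassCurve.Affine WeierstrassCurve.Affine.Point
  Summit.BirchSwinnertonDyer.BirchSwinnertonDyer.Theorems.SylvesterTwoCMNormForm
  Literature.NumberTheory.EllipticCurves.HuShuYin2019

namespace Summit.BirchSwinnertonDyer.BirchSwinnertonDyer.Theorems.SylvesterTwoNonneg

/-! ## §1 The exact `2`-adic valuation from the height identity -/

section Valuation

variable {K : Type*} [Field K] [NumberField K] {W : WeierstrassCurve K} [W.IsElliptic] {ω : K}
variable (hω : ω ^ 2 + ω + 1 = 0) (h1 : W.a₁ = 0) (h2 : W.a₂ = 0) (h3 : W.a₃ = 0) (h4 : W.a₄ = 0)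
variable {θ : W.toAffine.Point → W.toAffine.Point} (hθ0 : θ 0 = 0)
  (hθ : ∀ (x y : K) (h : W.toAffine.Nonsingular x y),
    θ (.some x y h) = .some (ω * x) y (nonsingular_omega_mul hω h1 h2 h3 h4 h))

include hω h1 h2 h3 h4 hθ0 hθ

/-- **The rational number behind the height identity.** On a Mordell equation over a number field
`K ∋ ω` with `θ = [ω]`: if `P` is non-torsion, `n·Y = a·P + b·θP + T` (`n ≠ 0`, `T` torsion) and
`q·ĥ(P) = 2^i·ĥ(Y)` for a rational `q`, then `q = 2^i·(a² − ab + b²)/n²` — the norm form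
(`canonicalHeight_zsmul_add_zsmul_omegaRot`) divided by `ĥ(P) ≠ 0`.
[cite: HuShuYin2019, p. 12 (bsd) and p. 8] -/
theorem eq_two_zpow_mul_norm_div_sq_of_height_identity {P Y T : W.toAffine.Point}
    (hP : ¬IsOfFinAddOrder P) (hT : IsOfFinAddOrder T) {n a b : ℤ} (hn : n ≠ 0)
    (hY : n • Y = a • P + b • θ P + T) {q : ℚ} {i : ℤ}
    (hid : (q : ℝ) * canonicalHeight P = (2 : ℝ) ^ i * canonicalHeight Y) :
    q = (2 : ℚ) ^ i * (((a ^ 2 - a * b + b ^ 2 : ℤ) : ℚ) / ((n : ℚ) ^ 2)) := by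
  have hP' : canonicalHeight P ≠ 0 := fun h' => hP ((canonicalHeight_eq_zero_iff_holds P).mp h')
  have hnY : ((n : ℝ) ^ 2) * canonicalHeight Y =
      ((a : ℝ) ^ 2 - a * b + (b : ℝ) ^ 2) * canonicalHeight P := by
    rw [← canonicalHeight_zsmul_holds, hY, canonicalHeight_add_of_isOfFinAddOrder _ T hT,
      canonicalHeight_zsmul_add_zsmul_omegaRot hω h1 h2 h3 h4 hθ0 hθ]
  have hn2 : ((n : ℝ) ^ 2) ≠ 0 := pow_ne_zero 2 (by exact_mod_cast hn)
  have hqR : (q : ℝ) = (2 : ℝ) ^ i * (((a : ℝ) ^ 2 - a * b + (b : ℝ) ^ 2) / (n : ℝ) ^ 2) := by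
    have hY' : canonicalHeight Y =
        ((a : ℝ) ^ 2 - a * b + (b : ℝ) ^ 2) / (n : ℝ) ^ 2 * canonicalHeight P := by
      rw [div_mul_eq_mul_div, eq_div_iff hn2]
      linear_combination hnY
    have : (q : ℝ) * canonicalHeight P =
        (2 : ℝ) ^ i * (((a : ℝ) ^ 2 - a * b + (b : ℝ) ^ 2) / (n : ℝ) ^ 2) * canonicalHeight P := by
      rw [hid, hY']
      ring
    exact mul_right_cancel₀ hP' this
  have : ((2 : ℚ) ^ i * ((((a ^ 2 - a * b + b ^ 2 : ℤ) : ℚ)) / ((n : ℚ) ^ 2)) : ℝ) =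
      (2 : ℝ) ^ i * (((a : ℝ) ^ 2 - a * b + (b : ℝ) ^ 2) / (n : ℝ) ^ 2) := by push_cast; ring
  exact_mod_cast (hqR.trans this.symm)

/-- **THE EXACT `2`-ADIC VALUATION**: under the same hypotheses with `q ≠ 0`,
`ord₂ q = i + ord₂((a² − ab + b²)/n²)`. [cite: HuShuYin2019, p. 12 (bsd) and p. 8] -/
theorem padicValRat_two_of_height_identity {P Y T : W.toAffine.Point} (hP : ¬IsOfFinAddOrder P)
    (hT : IsOfFinAddOrder T) {n a b : ℤ} (hn : n ≠ 0) (hY : n • Y = a • P + b • θ P + T) {q : ℚ}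
    (hq : q ≠ 0) {i : ℤ} (hid : (q : ℝ) * canonicalHeight P = (2 : ℝ) ^ i * canonicalHeight Y) :
    padicValRat 2 q = i + padicValRat 2 (((a ^ 2 - a * b + b ^ 2 : ℤ) : ℚ) / ((n : ℚ) ^ 2)) := by
  have hq' := eq_two_zpow_mul_norm_div_sq_of_height_identity hω h1 h2 h3 h4 hθ0 hθ hP hT hn hY hid
  have hne : ((((a ^ 2 - a * b + b ^ 2 : ℤ) : ℚ)) / ((n : ℚ) ^ 2)) ≠ 0 := by
    intro h0
    rw [h0, mul_zero] at hq'
    exact hq hq'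
  have h22 : padicValRat 2 (2 : ℚ) = 1 := by exact_mod_cast padicValRat.self one_lt_two
  rw [hq', padicValRat.mul (zpow_ne_zero i two_ne_zero) hne, padicValRat.zpow, h22, mul_one]

/-- `(a, b) ≠ (0, 0)` under the same hypotheses with `q ≠ 0` (else `Y` would have height `0` and
`q·ĥ(P) = 0`). [folklore] -/
theorem coeffs_ne_zero_of_height_identity {P Y T : W.toAffine.Point} (hP : ¬IsOfFinAddOrder P)
    (hT : IsOfFinAddOrder T) {n a b : ℤ} (hn : n ≠ 0) (hY : n • Y = a • P + b • θ P + T) {q : ℚ}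
    (hq : q ≠ 0) {i : ℤ} (hid : (q : ℝ) * canonicalHeight P = (2 : ℝ) ^ i * canonicalHeight Y) :
    ¬ (a = 0 ∧ b = 0) := by
  rintro ⟨rfl, rfl⟩
  have hq' := eq_two_zpow_mul_norm_div_sq_of_height_identity hω h1 h2 h3 h4 hθ0 hθ hP hT hn hY hid
  simp only [ne_eq, OfNat.ofNat_ne_zero, not_false_eq_true, zero_pow, mul_zero, sub_self, add_zero,
    Int.cast_zero, zero_div] at hq'
  exact hq hq'

end Valuation

/-! ## §2 `ord₂ q = 2m`, `m ∈ ℕ`, along Hu–Shu–Yin's generator on `E_p ⊗ K` -/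

section Sylvester

variable {K : Type} [Field K] [NumberField K] {ω : K}

/-- An even integer which is `≥ 0` is `2m` with `m ∈ ℕ`. [folklore] -/
theorem exists_nat_eq_two_mul_of_even_of_nonneg {v : ℤ} (hv : Even v) (h0 : 0 ≤ v) :
    ∃ m : ℕ, v = 2 * m := by
  obtain ⟨k, hk⟩ := hv
  refine ⟨k.toNat, ?_⟩
  have hk0 : 0 ≤ k := by omega
  rw [Int.toNat_of_nonneg hk0]; omega

/-- **The `p ≡ 4 (mod 9)` layer of `TwoAdicPairHSY`, class-wide, in `θ`-currency (i = 0).** On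
`E_p ⊗ K` (`K/ℚ` quadratic containing `ω`, `p` an odd prime, `θ = [ω]`): let `P` be a point with
rational coordinates, of infinite order, through which every rational-coordinate point is an integer
multiple modulo torsion (Hu–Shu–Yin's generator of `E_p(ℚ)`), let `n·Y = a·P + b·θP + T` (`n ≠ 0`, `T`
torsion; HSY p. 8 `K ⊗_{𝒪_K} E_p(K) ≃ K`) and let a rational `q ≠ 0` satisfy `q·ĥ(P) = ĥ(Y)` (HSY
p. 12 (bsd) with `i = 0`: `q = #Ш_an(E_p)·#Ш_an(E_{3p²})`). Then `ord₂ q = 2m` with `m ∈ ℕ` — PARITY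
(x1b, `2` inert) ∧ NON-NEGATIVITY (this seat, the generator is not halvable). No Theorem C, no odd-index
lemma beyond its weak kernel form, no fact at the prime `2`. [cite: HuShuYin2019, pp. 8, 12] -/
theorem exists_nat_padicValRat_two_eq_of_generator (h2K : Module.finrank ℚ K = 2)
    (hω : ω ^ 2 + ω + 1 = 0) {p : ℕ} (hp : p.Prime) (hp2 : p ≠ 2)
    (h1 : ((cubeSumCurve (p : ℚ)).baseChange K).a₁ = 0) (h2 : ((cubeSumCurve (p : ℚ)).baseChange K).a₂ = 0)
    (h3 : ((cubeSumCurve (p : ℚ)).baseChange K).a₃ = 0) (h4 : ((cubeSumCurve (p : ℚ)).baseChange K).a₄ = 0)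
    {θ : ((cubeSumCurve (p : ℚ)).baseChange K).toAffine.Point →
      ((cubeSumCurve (p : ℚ)).baseChange K).toAffine.Point} (hθ0 : θ 0 = 0)
    (hθ : ∀ (x y : K) (h : ((cubeSumCurve (p : ℚ)).baseChange K).toAffine.Nonsingular x y),
      θ (.some x y h) = .some (ω * x) y (nonsingular_omega_mul hω h1 h2 h3 h4 h))
    {xP yP : ℚ}
    (hP : ((cubeSumCurve (p : ℚ)).baseChange K).toAffine.Nonsingular (algebraMap ℚ K xP)
      (algebraMap ℚ K yP))
    (hPinf : ¬ IsOfFinAddOrder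
      (Affine.Point.some _ _ hP : ((cubeSumCurve (p : ℚ)).baseChange K).toAffine.Point))
    (hgen : ∀ (x y : ℚ) (hQ : ((cubeSumCurve (p : ℚ)).baseChange K).toAffine.Nonsingular
        (algebraMap ℚ K x) (algebraMap ℚ K y)),
      ∃ m : ℤ, (Affine.Point.some _ _ hQ : ((cubeSumCurve (p : ℚ)).baseChange K).toAffine.Point) -
        m • Affine.Point.some _ _ hP ∈
          AddCommGroup.torsion ((cubeSumCurve (p : ℚ)).baseChange K).toAffine.Point)
    {Y T : ((cubeSumCurve (p : ℚ)).baseChange K).toAffine.Point} {n a b : ℤ} (hn : n ≠ 0)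
    (hT : IsOfFinAddOrder T) (hY : n • Y = a • Affine.Point.some _ _ hP + b • θ (.some _ _ hP) + T)
    {q : ℚ} (hq : q ≠ 0)
    (hid : (q : ℝ) * canonicalHeight (Affine.Point.some _ _ hP :
      ((cubeSumCurve (p : ℚ)).baseChange K).toAffine.Point) = canonicalHeight Y) :
    ∃ m : ℕ, padicValRat 2 q = 2 * m := by
  haveI : (cubeSumCurve (p : ℚ)).IsElliptic := by
    rw [cubeSumCurve_eq_mordellCurve]
    exact Literature.NumberTheory.EllipticCurves.isElliptic_mordellCurve (neg_ne_zero.mpr (mul_ne_zero (by norm_num)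
      (pow_ne_zero 2 (by exact_mod_cast hp.ne_zero))))
  have hid' : (q : ℝ) * canonicalHeight (Affine.Point.some _ _ hP :
      ((cubeSumCurve (p : ℚ)).baseChange K).toAffine.Point) = (2 : ℝ) ^ (0 : ℤ) * canonicalHeight Y := by
    rw [hid, zpow_zero, one_mul]
  have hpar := even_padicValRat_two_of_height_identity hω h1 h2 h3 h4 hθ0 hθ hPinf hT hn hY hq
    (i := 0) ⟨0, rfl⟩ hid'
  have hval := padicValRat_two_of_height_identity hω h1 h2 h3 h4 hθ0 hθ hPinf hT hn hY hq hid'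
  have hnn := padicValRat_two_coordinate_nonneg h2K hω hp hp2 h1 h2 h3 h4 hθ0 hθ hP hPinf hgen hn hT hY
  exact exists_nat_eq_two_mul_of_even_of_nonneg hpar (by rw [hval]; push_cast at hnn ⊢; linarith)

/-- **The `p ≡ 7 (mod 9)` layer of `TwoAdicPairHSY` in `θ`-currency (i = −2), modulo THEOREM C.** Same
setting with `q·ĥ(P) = 2^{−2}·ĥ(Y)` (HSY p. 12 (bsd) with `i = −2`) and the DISPLAYED hypothesis
`hC : Y ∈ 2·E_p(K) + tors` — MEMO bsd-cm-two v2.6 §15.5 THEOREM C («Hu–Shu–Yin's Heegner point is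
`2`-divisible over `K` for every `p ≡ 7 (9)`», Shimura reciprocity on `X_0(3⁵)`; refereed cell theorem,
NOT in print, NOT proved here, never a Literature fact). Then `ord₂ q = 2m`, `m ∈ ℕ`.
[cite: HuShuYin2019, pp. 8, 12] -/
theorem exists_nat_padicValRat_two_eq_of_twoDivisible (h2K : Module.finrank ℚ K = 2)
    (hω : ω ^ 2 + ω + 1 = 0) {p : ℕ} (hp : p.Prime) (hp2 : p ≠ 2)
    (h1 : ((cubeSumCurve (p : ℚ)).baseChange K).a₁ = 0) (h2 : ((cubeSumCurve (p : ℚ)).baseChange K).a₂ = 0)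
    (h3 : ((cubeSumCurve (p : ℚ)).baseChange K).a₃ = 0) (h4 : ((cubeSumCurve (p : ℚ)).baseChange K).a₄ = 0)
    {θ : ((cubeSumCurve (p : ℚ)).baseChange K).toAffine.Point →
      ((cubeSumCurve (p : ℚ)).baseChange K).toAffine.Point} (hθ0 : θ 0 = 0)
    (hθ : ∀ (x y : K) (h : ((cubeSumCurve (p : ℚ)).baseChange K).toAffine.Nonsingular x y),
      θ (.some x y h) = .some (ω * x) y (nonsingular_omega_mul hω h1 h2 h3 h4 h))
    {xP yP : ℚ}
    (hP : ((cubeSumCurve (p : ℚ)).baseChange K).toAffine.Nonsingular (algebraMap ℚ K xP)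
      (algebraMap ℚ K yP))
    (hPinf : ¬ IsOfFinAddOrder
      (Affine.Point.some _ _ hP : ((cubeSumCurve (p : ℚ)).baseChange K).toAffine.Point))
    (hgen : ∀ (x y : ℚ) (hQ : ((cubeSumCurve (p : ℚ)).baseChange K).toAffine.Nonsingular
        (algebraMap ℚ K x) (algebraMap ℚ K y)),
      ∃ m : ℤ, (Affine.Point.some _ _ hQ : ((cubeSumCurve (p : ℚ)).baseChange K).toAffine.Point) -
        m • Affine.Point.some _ _ hP ∈
          AddCommGroup.torsion ((cubeSumCurve (p : ℚ)).baseChange K).toAffine.Point)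
    {Y T : ((cubeSumCurve (p : ℚ)).baseChange K).toAffine.Point} {n a b : ℤ} (hn : n ≠ 0)
    (hT : IsOfFinAddOrder T) (hY : n • Y = a • Affine.Point.some _ _ hP + b • θ (.some _ _ hP) + T)
    {q : ℚ} (hq : q ≠ 0)
    (hid : (q : ℝ) * canonicalHeight (Affine.Point.some _ _ hP :
      ((cubeSumCurve (p : ℚ)).baseChange K).toAffine.Point) = (2 : ℝ) ^ (-2 : ℤ) * canonicalHeight Y)
    (hC : ∃ Y' T' : ((cubeSumCurve (p : ℚ)).baseChange K).toAffine.Point,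
      IsOfFinAddOrder T' ∧ Y = (2 : ℤ) • Y' + T') :
    ∃ m : ℕ, padicValRat 2 q = 2 * m := by
  haveI : (cubeSumCurve (p : ℚ)).IsElliptic := by
    rw [cubeSumCurve_eq_mordellCurve]
    exact Literature.NumberTheory.EllipticCurves.isElliptic_mordellCurve (neg_ne_zero.mpr (mul_ne_zero (by norm_num)
      (pow_ne_zero 2 (by exact_mod_cast hp.ne_zero))))
  have hpar := even_padicValRat_two_of_height_identity hω h1 h2 h3 h4 hθ0 hθ hPinf hT hn hY hq
    (i := -2) ⟨-1, rfl⟩ hid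
  have hval := padicValRat_two_of_height_identity hω h1 h2 h3 h4 hθ0 hθ hPinf hT hn hY hq hid
  have hab := coeffs_ne_zero_of_height_identity hω h1 h2 h3 h4 hθ0 hθ hPinf hT hn hY hq hid
  have h2le := two_le_padicValRat_two_coordinate_of_twoDivisible h2K hω hp hp2 h1 h2 h3 h4 hθ0 hθ hP
    hPinf hgen hn hT hY hab hC
  exact exists_nat_eq_two_mul_of_even_of_nonneg hpar (by rw [hval]; push_cast at h2le ⊢; linarith)

end Sylvester

end Summit.BirchSwinnertonDyer.BirchSwinnertonDyer.Theorems.SylvesterTwoNonneg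

end
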